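import Summits.AtomisticToContinuum.HydrodynamicLimit.Theorems.JParityClosureOddContactSymmetryWindowStaticsOne
import Literature.MathematicalPhysics.KineticTheory.HardSphereEulerProofs
import Literature.Analysis.FluidPDE.HardSpherePhaseSpace
import HarnessLib

/-!
# The static pair shell of velocity-dependent width under the equilibrium law
# (`LambertianContactSwap.LambertianEuler`, stmt-AtomisticToContinuum-11854, line `Sketch`;
# sub-goal `localGibbsLaw_pairShellVel_le` of the `N`-uniform equilibrium collision rate)

Under the homogeneous local Gibbs law of `N + 1` hard spheres of diameter `ε = hsDiameter σ N` on
`𝕋³` (constant profiles `b, ϑ > 0`, `w`; positions hard-core canonical, velocities i.i.d.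
Maxwellian `N(w, ϑ id)` — `localGibbsMeasure_rung0_eq_map`), the event that a fixed pair `i ≠ j`
sits at minimal-image distance in `[ε, ε + δ ‖vᵢ − vⱼ‖]` has probability
`≤ C₁ ε² δ + C₂ δ²` with `C₁ = C₁(w, ϑ)` UNIFORM in `N` (and in `σ`, `b`), `C₂ = C₂(w, ϑ, ε)`.

Route.  `‖vᵢ − vⱼ‖ ≤ ‖vᵢ‖ + ‖vⱼ‖`, so the event is contained in the one-pair window event
`{ε ≤ d(xᵢ, xⱼ) ≤ ε + (‖vᵢ‖ + ‖vⱼ‖) δ}` of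
`…JParityClosureOddContactSymmetryWindowStaticsOne.prod_pairWindow_le` (Tonelli with the positions
inside: the pair-shell bound `posGibbsMeasure_pairShell_le` — pair marginal `≤ 2² vol` and the sharp
shell volume `v₁((ε + w)³ − ε³)` — then the Maxwellian first/second moments
`lintegral_pairWindow_le`), whose bound is
`12 v₁ ε² · 2E‖v‖ · δ + 4 K(ε) E‖v‖² δ²`; take `C₁ := 12 v₁ · 2E‖v‖ + 1`, `C₂ := 4 K(ε) E‖v‖² + 1`.

References: Cercignani–Illner–Pulvirenti 1994 §2.2 (collision cylinder); Gallagher–Saint-Raymond–Texier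
2013, Lemma 4.1.2.
-/

noncomputable section

open scoped BigOperators Topology ENNReal InnerProductSpace
open MeasureTheory ProbabilityTheory Filter Set
open Literature.MathematicalPhysics.KineticTheory Literature.MathematicalPhysics.StatisticalMechanics
open Literature.Analysis.FluidPDE

namespace Summit.AtomisticToContinuum.HydrodynamicLimit.Theorems.LambertianContactSwapLambertianEulerPairShellVel

/-- **The velocity-width pair shell is contained in the one-pair window event** (product
coordinates): `δ ‖vᵢ − vⱼ‖ ≤ (‖vᵢ‖ + ‖vⱼ‖) δ` for `δ ≥ 0`, and `‖sepVec x y‖ = d(x, y)`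
(`Torus.norm_geometry_sepVec`). [folklore] -/
theorem preimage_zipConfig_pairShellVel_subset {σ : ℝ} {N : ℕ} (i j : Fin (N + 1)) {δ : ℝ}
    (hδ : 0 ≤ δ) :
    (zipConfig : (Fin (N + 1) → T3) × (Fin (N + 1) → V3) → Config (N + 1) (Fin 3) T3) ⁻¹'
        {z : Config (N + 1) (Fin 3) T3 |
          hsDiameter σ N ≤ ‖(Torus.geometry (Fin 3)).sepVec (z i).1 (z j).1‖ ∧
            ‖(Torus.geometry (Fin 3)).sepVec (z i).1 (z j).1‖ ≤
              hsDiameter σ N + δ * ‖(z i).2 - (z j).2‖} ⊆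
      {p | hsDiameter σ N ≤ Torus.euclidDist (p.1 i) (p.1 j) ∧
        Torus.euclidDist (p.1 i) (p.1 j) ≤ hsDiameter σ N + (‖p.2 i‖ + ‖p.2 j‖) * δ} := by
  intro p hp
  simp only [mem_preimage, mem_setOf_eq, zipConfig_apply, Torus.norm_geometry_sepVec] at hp
  refine ⟨hp.1, hp.2.trans ?_⟩
  have h : δ * ‖p.2 i - p.2 j‖ ≤ δ * (‖p.2 i‖ + ‖p.2 j‖) :=
    mul_le_mul_of_nonneg_left (norm_sub_le _ _) hδ
  linarith

/-- **The static pair shell of velocity-dependent width, `N`-uniformly in the linear term.**  For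
constant profiles `b, ϑ > 0`, `w` there is `C₁ > 0` (depending on `w, ϑ` only) such that for
`0 < σ < 1/2` with `v₁ σ³ ≤ 1/2`, every `N` and `Φ`, there is `C₂ > 0` with, for all `i ≠ j` and
`δ ≥ 0`: under the local Gibbs law `G` of diameter `ε = hsDiameter σ N`,
`G {ε ≤ ‖sepVec xᵢ xⱼ‖ ≤ ε + δ ‖vᵢ − vⱼ‖} ≤ C₁ ε² δ + C₂ δ²`
(containment in the one-pair window event and `prod_pairWindow_le`). [folklore] -/
theorem localGibbsLaw_pairShellVel_le :
    ∀ (b ϑ : ℝ) (w : V3), 0 < b → 0 < ϑ → ∃ C₁ : ℝ, 0 < C₁ ∧ ∀ σ : ℝ, 0 < σ → σ < 2⁻¹ → v₁ * σ ^ 3 ≤ 1 / 2 →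
      ∀ (N : ℕ) (Φ : HardSphereFlow (Torus.geometry (Fin 3)) (hsDiameter σ N) (N + 1)), ∃ C₂ : ℝ, 0 < C₂ ∧
        ∀ (i j : Fin (N + 1)), i ≠ j → ∀ δ : ℝ, 0 ≤ δ →
          localGibbsLaw σ (fun _ => b) (fun _ => w) (fun _ => ϑ) N Φ
              {z | hsDiameter σ N ≤ ‖(Torus.geometry (Fin 3)).sepVec (z i).1 (z j).1‖ ∧
                ‖(Torus.geometry (Fin 3)).sepVec (z i).1 (z j).1‖ ≤ hsDiameter σ N + δ * ‖(z i).2 - (z j).2‖} ≤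
            ENNReal.ofReal (C₁ * hsDiameter σ N ^ 2 * δ + C₂ * δ ^ 2) := by
  intro b ϑ w hb hϑ
  have hv := v₁_pos
  -- the Maxwellian moments (depend on `w, ϑ` only)
  have hm₁ : 0 ≤ ∫ v, ‖v‖ ∂gaussMeasure w ϑ := integral_nonneg fun _ => norm_nonneg _
  have hm₂ : 0 ≤ ∫ v, ‖v‖ ^ 2 ∂gaussMeasure w ϑ := integral_nonneg fun _ => by positivity
  refine ⟨12 * v₁ * (2 * ∫ v, ‖v‖ ∂gaussMeasure w ϑ) + 1, by positivity, ?_⟩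
  intro σ hσ hσ2' hlam N Φ
  have hσ2 : σ < 1 / 2 := by simpa only [one_div] using hσ2'
  have hε : 0 < hsDiameter σ N := hsDiameter_pos hσ N
  have hK : 0 ≤ 2 ^ 2 * v₁ * (3 * hsDiameter σ N + 1) + (1 / 2 - hsDiameter σ N)⁻¹ ^ 2 := by
    positivity
  refine ⟨4 * (2 ^ 2 * v₁ * (3 * hsDiameter σ N + 1) + (1 / 2 - hsDiameter σ N)⁻¹ ^ 2) *
    (∫ v, ‖v‖ ^ 2 ∂gaussMeasure w ϑ) + 1, by positivity, ?_⟩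
  intro i j hij δ hδ
  have hz : MeasurableEmbedding
      (zipConfig : (Fin (N + 1) → T3) × (Fin (N + 1) → V3) → Config (N + 1) (Fin 3) T3) :=
    (MeasurableEquiv.arrowProdEquivProdArrow T3 V3 (Fin (N + 1))).symm.measurableEmbedding
  rw [localGibbsLaw_eq, localGibbsMeasure_rung0_eq_map σ hb.le hϑ w N, hz.map_apply]
  calc ((posGibbsMeasure (fun _ : T3 => b) (hsDiameter σ N) (N + 1)).prod
          (Measure.pi fun _ : Fin (N + 1) => gaussMeasure w ϑ)) _
      ≤ ((posGibbsMeasure (fun _ : T3 => b) (hsDiameter σ N) (N + 1)).prod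
          (Measure.pi fun _ : Fin (N + 1) => gaussMeasure w ϑ))
          {p | hsDiameter σ N ≤ Torus.euclidDist (p.1 i) (p.1 j) ∧
            Torus.euclidDist (p.1 i) (p.1 j) ≤ hsDiameter σ N + (‖p.2 i‖ + ‖p.2 j‖) * δ} :=
        measure_mono (preimage_zipConfig_pairShellVel_subset i j hδ)
    _ ≤ ENNReal.ofReal (12 * v₁ * hsDiameter σ N ^ 2 * (2 * ∫ v, ‖v‖ ∂gaussMeasure w ϑ) * δ +
          4 * (2 ^ 2 * v₁ * (3 * hsDiameter σ N + 1) + (1 / 2 - hsDiameter σ N)⁻¹ ^ 2) *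
            (∫ v, ‖v‖ ^ 2 ∂gaussMeasure w ϑ) * δ ^ 2) :=
        prod_pairWindow_le hσ hσ2 hlam hb w ϑ N hij hδ
    _ ≤ _ := by
        refine ENNReal.ofReal_le_ofReal ?_
        have h1 : 0 ≤ hsDiameter σ N ^ 2 * δ := by positivity
        have h2 : 0 ≤ δ ^ 2 := by positivity
        nlinarith [h1, h2]

end Summit.AtomisticToContinuum.HydrodynamicLimit.Theorems.LambertianContactSwapLambertianEulerPairShellVel

end
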